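import Summits.FinalStateConjecture.FinalStateConjecture.Theses.PhaseMixingCapture
import Summits.FinalStateConjecture.FinalStateConjecture.Theses.SwallowTheDatum
import Literature.Geometry.Lorentzian.KerrDataProofs
import Literature.Geometry.Lorentzian.KerrSchildCoord
import Literature.Geometry.Lorentzian.ModelData

/-!
# Crux `WeakCosmicCensorshipMGHD` (stmt-FinalStateConjecture-9952) — ideator 3 sketch (round 1)

First lemmas of two crux idea cards, typed over existing declarations:

* card `throat-shadow-time-symmetric-shield`: `IsEREnded`, `ParametricBridgeBurial`,
  `BridgeSheetFarComplete`, `EREndedCensored`, and the PROVED compositions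
  `erEndedCensored_of_sheet`, `wcc_of_bridgeBurial`;
* card `scri-ascends-from-censored-subdata`: `FarCompleteAlong`, `ScriAscends`,
  `CensoredSubdatumFamilies` and the PROVED composition `wcc_of_ascent`.

Nothing here is a proof of the crux; the `def`s are candidate stubs, the theorems are pure logic.
-/

noncomputable section

open scoped Manifold ContDiff Topology ENNReal
open Set Function Literature.Geometry.Lorentzian

namespace Summit.FinalStateConjecture.FinalStateConjecture.Cruxes.WeakCosmicCensorshipMGHD.Ideator3

/-! ### Card B objects: far-complete sub-data developments and the ascent lemma -/

/-- The vacuum Cauchy development `𝒟'` of a SUB-datum living on `N`, placed inside `X` by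
`Φ : N → X`, is **far-complete along `Φ`**: Christodoulou's sojourn form of complete `𝓘⁺` for
`𝒟'`, with ray ORIGINS restricted to points `p : N` whose image `Φ p` lies outside a compact
subset of the AMBIENT manifold `X` (so the inner edge of `N` is never an origin — the pattern of
`HasCompleteFutureNullInfinityFar`, made relative to an arbitrary co-compact placement). -/
def FarCompleteAlong {X N : Type} [TopologicalSpace X] [TopologicalSpace N] [ChartedSpace E3 N]
    [IsManifold (𝓡 3) ∞ N] [ConnectedSpace N] {D' : InitialDataSet (𝓡 3) N}
    (𝒟' : VacuumCauchyDevelopment D') (Φ : N → X) : Prop :=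
  ∀ [𝒟'.metric.HasLeviCivita], ∃ B₀ : Set N, IsCompact B₀ ∧ ∀ s : ℝ, 0 < s →
    ∃ B₁ : Set X, IsCompact B₁ ∧ ∀ p : N, Φ p ∉ B₁ →
      ∀ (γ : ℝ → 𝒟'.carrier) (dom : Set ℝ),
        𝒟'.metric.IsNormalisedNullRayFrom 𝒟'.timeOrientation 𝒟'.embed 𝒟'.normal p γ dom →
          ¬ BddAbove dom ∨ ENNReal.ofReal s ≤
            sojournTime γ dom (𝒟'.metric.causalFuture 𝒟'.timeOrientation (𝒟'.embed '' B₀))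

/-- **Scri ascends** (transfer lemma, provable now modulo the geodesic-uniqueness named fact):
if a vacuum Cauchy development `𝒟'` of the co-compact sub-datum `Φ^* D` embeds into the vacuum
Cauchy development `𝒟` of `D` (isometrically, time-orientation preserving, over `Φ`) and `𝒟'` is
far-complete along `Φ`, then `𝒟` has complete future null infinity: rays of `𝒟` from far
origins extend the images of rays of `𝒟'`, causal futures and sojourn times only grow. -/
def ScriAscends : Prop :=
  ∀ (X : Type) [TopologicalSpace X] [ChartedSpace E3 X]
    [IsManifold (𝓡 3) ((⊤ : ℕ∞) : WithTop ℕ∞) X] [T2Space X] [SecondCountableTopology X]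
    [ConnectedSpace X] (D : InitialDataSet (𝓡 3) X) (𝒟 : VacuumCauchyDevelopment D)
    (N : Type) [TopologicalSpace N] [ChartedSpace E3 N]
    [IsManifold (𝓡 3) ((⊤ : ℕ∞) : WithTop ℕ∞) N] [ConnectedSpace N] (Φ : N → X)
    (hΦ : ContMDiff (𝓡 3) (𝓡 3) (((⊤ : ℕ∞) : WithTop ℕ∞) + 1) Φ)
    (hΦ' : ∀ u, Function.Injective (mfderiv (𝓡 3) (𝓡 3) Φ u)),
    Topology.IsOpenEmbedding Φ → IsCompact (Set.range Φ)ᶜ →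
    ∀ (𝒟' : VacuumCauchyDevelopment (D.comap Φ hΦ hΦ')) (χ : 𝒟'.carrier → 𝒟.carrier),
      ContMDiff (𝓡 4) (𝓡 4) ((⊤ : ℕ∞) : WithTop ℕ∞) χ → Topology.IsOpenEmbedding χ →
      𝒟'.metric.IsIsometricImmersion 𝒟.metric.toPseudoRiemannianMetric χ →
      𝒟'.timeOrientation.PreservesTimeOrientation χ 𝒟.timeOrientation →
      χ ∘ 𝒟'.embed = 𝒟.embed ∘ Φ →
      FarCompleteAlong 𝒟' Φ →
        Summit.FinalStateConjecture.HasCompleteNullInfinity 𝒟.toCauchyDevelopment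

/-- **Censored-subdatum families** (the shield-agnostic generic input of card B): through every
admissible datum passes a jointly smooth injective admissible family all of whose members
`F c`, `c ≠ 0`, carry SOME co-compact sub-datum possessing SOME vacuum Cauchy development which
is far-complete along the placement. Instances: Kerr–Schild-shielded members
(`SwallowTheDatum.ParametricKerrBurial` + the Kerr chart), ER-ended members (card A), and —
honestly — late near-Kerr horizon-penetrating sub-slices fed to the route's capture cruxes. -/
def CensoredSubdatumFamilies : Prop :=
  ∀ (X : Type) [TopologicalSpace X] [ChartedSpace E3 X]
    [IsManifold (𝓡 3) ((⊤ : ℕ∞) : WithTop ℕ∞) X] [T2Space X] [SecondCountableTopology X]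
    [ConnectedSpace X], ∀ d ∈ admissibleVacuumData X,
    ∃ F : EuclideanSpace ℝ (Fin 1) → InitialDataSet (𝓡 3) X,
      InitialDataSet.IsSmoothDataFamily 1 F ∧ F 0 = d ∧ Function.Injective F ∧
      (∀ c, F c ∈ admissibleVacuumData X) ∧
      ∀ c ≠ 0, ∃ (N : Type) (_ : TopologicalSpace N) (_ : ChartedSpace E3 N)
        (_ : IsManifold (𝓡 3) ((⊤ : ℕ∞) : WithTop ℕ∞) N) (_ : ConnectedSpace N) (Φ : N → X)
        (hΦ : ContMDiff (𝓡 3) (𝓡 3) (((⊤ : ℕ∞) : WithTop ℕ∞) + 1) Φ)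
        (hΦ' : ∀ u, Function.Injective (mfderiv (𝓡 3) (𝓡 3) Φ u)),
        Topology.IsOpenEmbedding Φ ∧ IsCompact (Set.range Φ)ᶜ ∧
        ∃ 𝒟' : VacuumCauchyDevelopment ((F c).comap Φ hΦ hΦ'), FarCompleteAlong 𝒟' Φ

/-- **Card B composition (pure logic, proved):** censored-subdatum families, exterior ignorance
(`SwallowTheDatum.SubdataDevelopmentsEmbed`), the ascent lemma and MGHD existence give the crux
`PhaseMixingCapture.WeakCosmicCensorshipMGHD`. -/
theorem wcc_of_ascent (hF : CensoredSubdatumFamilies)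
    (hE : Summit.FinalStateConjecture.FinalStateConjecture.Theses.SwallowTheDatum.SubdataDevelopmentsEmbed)
    (hA : ScriAscends)
    (hM : Summit.FinalStateConjecture.FinalStateConjecture.Theses.SwallowTheDatum.MGHDExists) :
    Summit.FinalStateConjecture.FinalStateConjecture.Theses.PhaseMixingCapture.WeakCosmicCensorshipMGHD := by
  intro X _ _ _ _ _ _ d hd
  obtain ⟨F, hFam, h0, hinj, hadm, hsub⟩ := hF X d hd.1
  refine ⟨F, hFam, h0, hinj, hadm, fun c hc hmem ↦ hmem.2 ⟨hM X (F c) (hadm c), ?_⟩⟩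
  intro 𝒟 h𝒟
  obtain ⟨N, _, _, _, _, Φ, hΦ, hΦ', hopen, hcpt, 𝒟', hfar⟩ := hsub c hc
  obtain ⟨χ, hχ, hχo, hiso, hτ, hcomm⟩ := hE X (F c) 𝒟 h𝒟 N Φ hΦ hΦ' hopen 𝒟'
  exact @hA X _ _ _ _ _ _ (F c) 𝒟 N _ _ _ _ Φ hΦ hΦ' hopen hcpt 𝒟' χ hχ hχo hiso hτ hcomm hfar

/-! ### Card A objects: the time-symmetric Einstein–Rosen end as a self-shadowing shield -/

/-- The datum `D` on `X` is **ER-ended**: outside a compact set it IS the open first sheet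
`{‖y‖ > M/2}` of the time-symmetric isotropic Schwarzschild slice `((1 + M/2‖y‖)⁴ δ, 0)`
(`Schwarzschild.conformalData` on `exteriorRegion (M/2)`), all the way down to — but excluding —
the minimal throat `‖y‖ = M/2`. Nothing is asked about where or how the rest of `X` is attached:
the open sheet is self-shadowing (its Kruskal domain of dependence is region I). -/
def IsEREnded {X : Type} [TopologicalSpace X] [ChartedSpace E3 X]
    [IsManifold (𝓡 3) ((⊤ : ℕ∞) : WithTop ℕ∞) X] (D : InitialDataSet (𝓡 3) X) : Prop :=
  ∃ (M : ℝ) (hM : 0 < M) (hU : (0 : E3) ∉ (exteriorRegion (M / 2) : Set E3))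
    (φ : exteriorRegion (M / 2) → X)
    (_hφ : ContMDiff 𝓘(ℝ, E3) (𝓡 3) (((⊤ : ℕ∞) : WithTop ℕ∞) + 1) φ)
    (_hφ' : ∀ u, Function.Injective (mfderiv 𝓘(ℝ, E3) (𝓡 3) φ u)),
    Topology.IsOpenEmbedding φ ∧ IsCompact (Set.range φ)ᶜ ∧
    (∀ y, pullbackBilin (I := 𝓡 3) (I' := 𝓘(ℝ, E3)) φ D.h.inner y =
        (Schwarzschild.conformalData (exteriorRegion (M / 2)) hM.le hU).h.inner y) ∧
    ∀ y, pullbackBilin (I := 𝓡 3) (I' := 𝓘(ℝ, E3)) φ D.k y = 0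

/-- **Parametric bridge burial** (card A, the gluing stub — time-symmetric far geometry): through
every admissible datum passes a jointly smooth, injective, admissible one-parameter family all
of whose members off the datum are ER-ended. -/
def ParametricBridgeBurial : Prop :=
  ∀ (X : Type) [TopologicalSpace X] [ChartedSpace E3 X]
    [IsManifold (𝓡 3) ((⊤ : ℕ∞) : WithTop ℕ∞) X] [T2Space X] [SecondCountableTopology X]
    [ConnectedSpace X], ∀ d ∈ admissibleVacuumData X,
    ∃ F : EuclideanSpace ℝ (Fin 1) → InitialDataSet (𝓡 3) X,
      InitialDataSet.IsSmoothDataFamily 1 F ∧ F 0 = d ∧ Function.Injective F ∧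
      (∀ c, F c ∈ admissibleVacuumData X) ∧ ∀ c ≠ 0, IsEREnded (F c)

/-- **The open Schwarzschild sheet develops far-completely** (card A, the certificate stub):
the sub-datum pulled back along the ER-end chart `φ` (exact isotropic Schwarzschild sheet-1 data)
has a vacuum Cauchy development which is far-complete along `φ` — intended witness: the static
exterior `ℝ × {‖y‖ > M/2}`, `g = −V² dt² + ψ⁴ δ`, `V = (1 − M/2‖y‖)/(1 + M/2‖y‖)`, where an
infalling normalised null ray from radius `R₁` enters `J⁺(ι B₀)` at areal radius
`≥ (R₁ + R₀)/2 − M log(R₁/R₀)` and needs affine time `≥ (r_entry − 2M)/E`, `E = V(R₁) ≤ 1`,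
to reach the horizon (`|dr/dλ| ≤ E`, `du/dλ ≥ 2|dr/dλ|`). -/
def BridgeSheetFarComplete : Prop :=
  ∀ (X : Type) [TopologicalSpace X] [ChartedSpace E3 X]
    [IsManifold (𝓡 3) ((⊤ : ℕ∞) : WithTop ℕ∞) X] [T2Space X] [SecondCountableTopology X]
    [ConnectedSpace X] (D : InitialDataSet (𝓡 3) X) (M : ℝ) (hM : 0 < M)
    (hU : (0 : E3) ∉ (exteriorRegion (M / 2) : Set E3)) [ConnectedSpace (exteriorRegion (M / 2))]
    (φ : exteriorRegion (M / 2) → X)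
    (hφ : ContMDiff 𝓘(ℝ, E3) (𝓡 3) (((⊤ : ℕ∞) : WithTop ℕ∞) + 1) φ)
    (hφ' : ∀ u, Function.Injective (mfderiv 𝓘(ℝ, E3) (𝓡 3) φ u)),
    Topology.IsOpenEmbedding φ → IsCompact (Set.range φ)ᶜ →
    (∀ y, pullbackBilin (I := 𝓡 3) (I' := 𝓘(ℝ, E3)) φ D.h.inner y =
        (Schwarzschild.conformalData (exteriorRegion (M / 2)) hM.le hU).h.inner y) →
    (∀ y, pullbackBilin (I := 𝓡 3) (I' := 𝓘(ℝ, E3)) φ D.k y = 0) →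
    ∃ 𝒟' : VacuumCauchyDevelopment (D.comap φ hφ hφ'), FarCompleteAlong 𝒟' φ

/-- **ER-ended data are censored** (card A's certificate, the 9952-specific statement): every
maximal vacuum Cauchy development of an ER-ended admissible datum has complete future null
infinity. -/
def EREndedCensored : Prop :=
  ∀ (X : Type) [TopologicalSpace X] [ChartedSpace E3 X]
    [IsManifold (𝓡 3) ((⊤ : ℕ∞) : WithTop ℕ∞) X] [T2Space X] [SecondCountableTopology X]
    [ConnectedSpace X], ∀ D ∈ admissibleVacuumData X, IsEREnded D →
    ∀ 𝒟 : VacuumCauchyDevelopment D, 𝒟.IsMaximal →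
      Summit.FinalStateConjecture.HasCompleteNullInfinity 𝒟.toCauchyDevelopment

/-- **Card A certificate from its two geometric stubs (pure logic, proved):** the sheet
development, exterior ignorance and the ascent lemma give `EREndedCensored`, granted connectedness
of the exterior regions (elementary; kept as a hypothesis here). -/
theorem erEndedCensored_of_sheet
    (hconn : ∀ R : ℝ, ConnectedSpace (exteriorRegion R))
    (hS : BridgeSheetFarComplete)
    (hE : Summit.FinalStateConjecture.FinalStateConjecture.Theses.SwallowTheDatum.SubdataDevelopmentsEmbed)
    (hA : ScriAscends) : EREndedCensored := by
  intro X _ _ _ _ _ _ D hD hER 𝒟 h𝒟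
  obtain ⟨M, hM, hU, φ, hφ, hφ', hopen, hcpt, hh, hk⟩ := hER
  haveI := hconn (M / 2)
  obtain ⟨𝒟', hfar⟩ := hS X D M hM hU φ hφ hφ' hopen hcpt hh hk
  obtain ⟨χ, hχ, hχo, hiso, hτ, hcomm⟩ := hE X D 𝒟 h𝒟 (exteriorRegion (M / 2)) φ hφ hφ' hopen 𝒟'
  exact @hA X _ _ _ _ _ _ D 𝒟 (exteriorRegion (M / 2)) _ _ _ _ φ hφ hφ' hopen hcpt 𝒟' χ hχ hχo hiso hτ
    hcomm hfar

/-- **Card A composition (pure logic, proved):** bridge burial, the certificate and MGHD existence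
give the crux, by unfolding `IsChristodoulouGeneric … 1 = HasCodimAtLeastIn 𝓓 {d ∈ 𝓓 | ¬P d} 1`. -/
theorem wcc_of_bridgeBurial (hB : ParametricBridgeBurial) (hC : EREndedCensored)
    (hM : Summit.FinalStateConjecture.FinalStateConjecture.Theses.SwallowTheDatum.MGHDExists) :
    Summit.FinalStateConjecture.FinalStateConjecture.Theses.PhaseMixingCapture.WeakCosmicCensorshipMGHD := by
  intro X _ _ _ _ _ _ d hd
  obtain ⟨F, hFam, h0, hinj, hadm, hER⟩ := hB X d hd.1
  exact ⟨F, hFam, h0, hinj, hadm, fun c hc hmem ↦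
    hmem.2 ⟨hM X (F c) (hadm c), fun 𝒟 h𝒟 ↦ hC X (F c) (hadm c) (hER c hc) 𝒟 h𝒟⟩⟩

/-- ER-ended burial is an instance of censored-subdatum families (card A feeds card B's input),
granted the sheet certificate and connectedness of exterior regions. Pure logic. -/
theorem censoredSubdatumFamilies_of_bridgeBurial
    (hconn : ∀ R : ℝ, ConnectedSpace (exteriorRegion R))
    (hB : ParametricBridgeBurial) (hS : BridgeSheetFarComplete) : CensoredSubdatumFamilies := by
  intro X _ _ _ _ _ _ d hd
  obtain ⟨F, hFam, h0, hinj, hadm, hER⟩ := hB X d hd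
  refine ⟨F, hFam, h0, hinj, hadm, fun c hc ↦ ?_⟩
  obtain ⟨M, hM, hU, φ, hφ, hφ', hopen, hcpt, hh, hk⟩ := hER c hc
  haveI := hconn (M / 2)
  obtain ⟨𝒟', hfar⟩ := hS X (F c) M hM hU φ hφ hφ' hopen hcpt hh hk
  exact ⟨exteriorRegion (M / 2), inferInstance, inferInstance, inferInstance, inferInstance,
    φ, hφ, hφ', hopen, hcpt, 𝒟', hfar⟩

/-! ### Card C objects: the censorship half of `KerrShieldedSettles` is separable -/

/-- `D` is **Kerr-shielded** — VERBATIM the hypothesis of `SwallowTheDatum.KerrShieldedSettles`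
and the `c ≠ 0` conclusion of `SwallowTheDatum.ParametricKerrBurial` (bent Kerr–Schild /
Boyer–Lindquist slice of sub-extremal Kerr outside a compact set, junction `r₁ ∈ (r₋, r₊)`). -/
def IsKerrShielded [Kerr.Facts] {X : Type} [TopologicalSpace X] [ChartedSpace E3 X]
    [IsManifold (𝓡 3) ((⊤ : ℕ∞) : WithTop ℕ∞) X] (D : InitialDataSet (𝓡 3) X) : Prop :=
  ∃ (M a r₁ : ℝ) (hM : 0 ≤ M) (T : ℝ → ℝ) (φ : Literature.Geometry.Lorentzian.Kerr.slice a r₁ → X) (ψ : Literature.Geometry.Lorentzian.Kerr.slice a r₁ → Literature.Geometry.Lorentzian.Kerr.region a r₁) (ν : Literature.Geometry.Lorentzian.NormalField 𝓘(ℝ, Literature.Geometry.Lorentzian.E4) ψ), |a| < M ∧ Literature.Geometry.Lorentzian.Kerr.rMinus M a < r₁ ∧ r₁ < Literature.Geometry.Lorentzian.Kerr.rPlus M a ∧ T = (fun r : ℝ => Real.smoothTransition (r / (4 * M) - 1) * (((M) / Real.sqrt ((M) ^ 2 - (a) ^ 2)) * (Literature.Geometry.Lorentzian.Kerr.rPlus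 M a * Real.log (r - Literature.Geometry.Lorentzian.Kerr.rPlus M a) - Literature.Geometry.Lorentzian.Kerr.rMinus M a * Real.log (r - Literature.Geometry.Lorentzian.Kerr.rMinus M a)) - ((M) / Real.sqrt ((M) ^ 2 - (a) ^ 2)) * (Literature.Geometry.Lorentzian.Kerr.rPlus M a * Real.log ((4 * M) - Literature.Geometry.Lorentzian.Kerr.rPlus M a) - Literature.Geometry.Lorentzian.Kerr.rMinus M a * Real.log ((4 * M) - Literature.Geometry.Lorentzian.Kerr.rMinus M a)))) ∧ IsCompact (Set.range φ)ᶜ ∧ Topology.IsOpenEmbedding φ ∧ ContMDiff 𝓘(ℝ, Literature.Geometry.Lorentzian.E3) (𝓡 3) ((⊤ : ℕ∞) : WithTop ℕ∞) φ ∧ (∀ y : Literature.Geometry.Lorentzian.Kerr.slice a r₁, (ψ y : Literature.Geometry.Lorentzian.E4) = Literature.Geometry.Lorentzian.E4.ofTimeSpace (T (Literature.Geometry.Lorentzian.Kerr.radius a (Literature.Geometry.Lorentzian.E4.ofTimeSpace 0 (y : Literature.Geometry.Lorentzian.E3)))) (y : Literature.Geometry.Lorentzian.E3)) ∧ (Literature.Geometry.Lorentzian.Kerr.smoothMetric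 M a r₁).IsSpacelikeImmersion 𝓘(ℝ, Literature.Geometry.Lorentzian.E3) ψ ∧ (Literature.Geometry.Lorentzian.Kerr.smoothMetric M a r₁).IsFutureUnitNormal 𝓘(ℝ, Literature.Geometry.Lorentzian.E3) ((Literature.Geometry.Lorentzian.Kerr.timeOrientation M a r₁ hM).ofLE le_top) ψ ν ∧ (∀ y : Literature.Geometry.Lorentzian.Kerr.slice a r₁, Literature.Geometry.Lorentzian.pullbackBilin (I := 𝓡 3) (I' := 𝓘(ℝ, Literature.Geometry.Lorentzian.E3)) φ D.h.inner y = Literature.Geometry.Lorentzian.pullbackBilin (I := 𝓘(ℝ, Literature.Geometry.Lorentzian.E4)) (I' := 𝓘(ℝ, Literature.Geometry.Lorentzian.E3)) ψ (Literature.Geometry.Lorentzian.Kerr.smoothMetric M a r₁).val y) ∧ (∀ [(Literature.Geometry.Lorentzian.Kerr.smoothMetric M a r₁).HasLeviCivita] (y : Literature.Geometry.Lorentzian.Kerr.slice a r₁), (Literature.Geometry.Lorentzian.pullbackBilin (I := 𝓡 3) (I' := 𝓘(ℝ, Literature.Geometry.Lorentzian.E3)) φ D.k y).toLinearMap₁₂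 = (Literature.Geometry.Lorentzian.Kerr.smoothMetric M a r₁).secondFundamentalForm 𝓘(ℝ, Literature.Geometry.Lorentzian.E3) ψ ν y)

/-- **The censorship half of `KerrShieldedSettles`** (card C): every maximal vacuum Cauchy
development of a Kerr-shielded admissible datum has complete future null infinity (sojourn form)
— the first conjunct of `SwallowTheDatum.KerrShieldedSettles`' conclusion, WITHOUT the `N = 1`
decomposition / exhaustive charts. -/
def KerrShieldedScriComplete : Prop :=
  ∀ [Kerr.Facts] (X : Type) [TopologicalSpace X] [ChartedSpace E3 X]
    [IsManifold (𝓡 3) ((⊤ : ℕ∞) : WithTop ℕ∞) X] [T2Space X] [SecondCountableTopology X]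
    [ConnectedSpace X], ∀ D ∈ admissibleVacuumData X, IsKerrShielded D →
    ∀ 𝒟 : VacuumCauchyDevelopment D, 𝒟.IsMaximal →
      Summit.FinalStateConjecture.HasCompleteNullInfinity 𝒟.toCauchyDevelopment

/-- Card C is STRICTLY WEAKER than the route crux 10054: `KerrShieldedSettles` implies it
(projection to the first conjunct; the shield predicates agree by `rfl`). Pure logic. -/
theorem kerrShieldedScriComplete_of_settles
    (h : Summit.FinalStateConjecture.FinalStateConjecture.Theses.SwallowTheDatum.KerrShieldedSettles) :
    KerrShieldedScriComplete :=
  fun X _ _ _ _ _ _ D hD hS 𝒟 h𝒟 ↦ (h X D hD hS 𝒟 h𝒟).1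

/-- **Card C composition (pure logic, proved):** the route's typed burial (item 10052, shared
verbatim), the censorship half of 10054 and MGHD existence (item 9937's decl) give the crux 9952. -/
theorem wcc_of_kerrBurial
    (hB : Summit.FinalStateConjecture.FinalStateConjecture.Theses.SwallowTheDatum.ParametricKerrBurial)
    (hC : KerrShieldedScriComplete)
    (hM : Summit.FinalStateConjecture.FinalStateConjecture.Theses.SwallowTheDatum.MGHDExists) :
    Summit.FinalStateConjecture.FinalStateConjecture.Theses.PhaseMixingCapture.WeakCosmicCensorshipMGHD := by
  haveI : Kerr.Facts :=
    ⟨Kerr.isConnected_region_holds, Kerr.contMDiff_bilin_holds, Kerr.contMDiff_timeVector_holds⟩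
  intro X _ _ _ _ _ _ d hd
  obtain ⟨F, hFam, h0, hinj, hadm, hKS⟩ := hB X d hd.1
  exact ⟨F, hFam, h0, hinj, hadm, fun c hc hmem ↦
    hmem.2 ⟨hM X (F c) (hadm c), fun 𝒟 h𝒟 ↦ hC X (F c) (hadm c) (hKS c hc) 𝒟 h𝒟⟩⟩

end Summit.FinalStateConjecture.FinalStateConjecture.Cruxes.WeakCosmicCensorshipMGHD.Ideator3

end
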